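import Summits.NavierStokesRegularity.NavierStokesRegularity.Theses.TautLoopKelvin
import Summits.NavierStokesRegularity.NavierStokesRegularity.Theorems.CirculationFloor.Negative.ClayVacuity
import Summits.NavierStokesRegularity.NavierStokesRegularity.Theorems.TautLoopKelvinTautCompressionIntegrableStubExtension

/-!
# Equivalence audit — crux `TautLoopKelvin.CirculationFloor` (stmt-NavierStokesRegularity-1538)

Strategist (cstrat, suspect = equivalence) scratch file. Kernel-checks the logical skeleton behind the
harness flag "`CirculationFloor` is equivalent to the Statement GIVEN the route's other cruxes":

* `cf_of_S`   — S → CirculationFloor (landed `ClayVacuity`, the trivial direction of any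
                 "blow-up ⇒ X" criterion: under (A) the hypothesis class is empty).
* `tci_of_S`  — S → TautCompressionIntegrable (landed `StubExtension.tautCompressionIntegrable_of_noBlowup`
                 + the same vacuity): the rank-2 sibling K1 is ALSO a consequence of S.
* `S_iff_tci_of_law_floor`, `S_iff_cf_of_tci_law` — so modulo the open crux `TautLoopLaw`, BOTH K1 and the
  Floor are "equivalent to S given the others"; the equivalences are `closes` read backwards. The
  summit-strength node is K1 (open content = NoTypeIBlowup ∧ NoTypeII per StubExtension), not the Floor
  (provable-now: 5/7 stubs of its line landed).
Nothing here is proposed to the tree.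
-/

namespace CstratAudit

open Summit.NavierStokesRegularity.NavierStokesRegularity

/-- (E1) `S → CirculationFloor`, from the landed vacuity lemma. -/
theorem cf_of_S (hA : _root_.NavierStokesRegularity) : Theses.TautLoopKelvin.CirculationFloor :=
  (Theorems.CirculationFloor.Negative.circulationFloor_iff_of_not_navierStokesRegularity).2
    (fun hnA => absurd hA hnA)

/-- (E2) `S → TautCompressionIntegrable`, from the landed regular-regime theorem and the same vacuity. -/
theorem tci_of_S (hA : _root_.NavierStokesRegularity) : Theses.TautLoopKelvin.TautCompressionIntegrable := by
  refine Theorems.TautCompressionIntegrable.Birth.tautCompressionIntegrable_of_noBlowup ?_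
  intro ν T hν hT u p hcl hLH hdec
  by_contra hext
  exact absurd hA
    (Theorems.CirculationFloor.Negative.circulationFloor_hypotheses_iff_not_navierStokesRegularity.1
      ⟨ν, T, u, p, hν, hT, hcl, hLH, hdec, hext⟩)

/-- (E3a) Given the open cruxes Law and Floor, `S ↔ K1` (K1 is the summit-strength node). -/
theorem S_iff_tci_of_law_floor (hLaw : Theses.TautLoopKelvin.TautLoopLaw)
    (hF : Theses.TautLoopKelvin.CirculationFloor) :
    _root_.NavierStokesRegularity ↔ Theses.TautLoopKelvin.TautCompressionIntegrable :=
  ⟨tci_of_S, fun h => Theses.TautLoopKelvin.closes h hLaw hF⟩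

/-- (E3b) Given the open cruxes K1 and Law, `S ↔ Floor` — the harness's flag, verbatim `closes` + (E1). -/
theorem S_iff_cf_of_tci_law (hK1 : Theses.TautLoopKelvin.TautCompressionIntegrable)
    (hLaw : Theses.TautLoopKelvin.TautLoopLaw) :
    _root_.NavierStokesRegularity ↔ Theses.TautLoopKelvin.CirculationFloor :=
  ⟨cf_of_S, fun h => Theses.TautLoopKelvin.closes hK1 hLaw h⟩

/-- (E3c) Given only Law, `S ↔ (K1 ∧ Floor)`: the route is an iff-criterion route whose new theorem is Law. -/
theorem S_iff_tci_and_cf_of_law (hLaw : Theses.TautLoopKelvin.TautLoopLaw) :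
    _root_.NavierStokesRegularity ↔
      (Theses.TautLoopKelvin.TautCompressionIntegrable ∧ Theses.TautLoopKelvin.CirculationFloor) :=
  ⟨fun hA => ⟨tci_of_S hA, cf_of_S hA⟩, fun h => Theses.TautLoopKelvin.closes h.1 hLaw h.2⟩

end CstratAudit
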